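import Summits.SmoothPoincare4.SmoothPoincare4.Theorems.EntropyRungSubcylindricalExistenceAnnulusPieceFloor

/-!
# The core piece floor (helper P1, stub `helper_corePieceFloor`)

Helper for the crux `SubcylindricalExistence` (ENT), route `EntropyRung`, line
`fat-conical-core-avr-logsobolev`, step K3 (capping assembly). Weighted conventions (c2) on the
background metric `g`: `c_σ = (4πσ)⁻²`, weight `Φ > 0`, potential `r ≥ 0`,
`F_{Φ,r}(v,σ) = ∫ (σ (r v² + 4 Φ⁻² |∇v|²_g) − v² log v² − 4 v²) c_σ Φ⁴ dV_g`, normalised test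
functions `∫ c_σ v² Φ⁴ dV_g = 1`.

**`helper_corePieceFloor`.** In the capping assembly the core piece's test functions live in a
region `S` away from the capping point `p`, on whose closure the realised conformal weight `Φ`
coincides with the exact cone factor `Λ`. If the `R`-free floor for `Λ` holds at level `3 log c`
for test functions vanishing near `p`, then every test function living in `S` satisfies the
weighted clause for `Φ` with any continuous potential `r_G ≥ 0` at the same level.

Proof. A test function `v` living in `S` vanishes on the open neighbourhood `(closure S)ᶜ` of `p`,
so the floor applies to `(v, σ)`; its normalisation and its `R`-free density for `Λ` agree
pointwise with those for `Φ` (on `closure S` because `Φ = Λ`, off it because `v` and `|∇v|²_g`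
vanish), and the `Φ`-density with potential `r_G` exceeds the `R`-free one by
`σ r_G v² c_σ Φ⁴ ≥ 0`. Both densities are continuous on the closed manifold, hence integrable.
Elementary (no literature needed).
-/

noncomputable section

open scoped Manifold ContDiff Topology ENNReal NNReal
open Set Filter MeasureTheory
open Literature.Geometry.Lorentzian Literature.Geometry.Riemannian

set_option linter.dupNamespace false

namespace Summit.SmoothPoincare4.SmoothPoincare4.Theorems

/-- **Core piece floor** (P1). If the weight `Φ` agrees with the cone factor `Λ` on the closure of
the core piece's region `S` (which avoids `p`), `r_G ≥ 0`, and the `R`-free floor for `Λ` at level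
`3 log c` holds for test functions vanishing near `p`, then every test function living in `S`
satisfies the weighted clause for `Φ` with potential `r_G` at level `3 log c`. -/
theorem helper_corePieceFloor :
    ∀ (M : Type) [TopologicalSpace M] [T2Space M] [SecondCountableTopology M]
      [ChartedSpace (EuclideanSpace ℝ (Fin 4)) M] [IsManifold (𝓡 4) ∞ M] [CompactSpace M]
      [T3Space M] [MeasurableSpace M] [BorelSpace M]
      (g : PseudoRiemannianMetric (𝓡 4) ∞ (EuclideanSpace ℝ (Fin 4)) (TangentSpace (𝓡 4) : M → Type _))
      [g.HasLeviCivita] (hg : g.IsRiemannian) (p : M) (Λ Φ rG : M → ℝ) (c : ℝ) (S : Set M),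
      ContMDiff (𝓡 4) 𝓘(ℝ, ℝ) ∞ Φ → (∀ x, 0 < Φ x) → Continuous rG → (∀ x, 0 ≤ rG x) →
      (∀ x ∈ closure S, x ≠ p ∧ Φ x = Λ x) → p ∉ closure S →
      (∀ τ : ℝ, 0 < τ → ∀ w : M → ℝ, ContMDiff (𝓡 4) 𝓘(ℝ, ℝ) ∞ w → w =ᶠ[𝓝 p] 0 →
        ∫ x, (4 * Real.pi * τ) ^ (-(4 : ℝ) / 2) * (w x) ^ 2 * (Λ x) ^ 4
            ∂(riemannianMeasure (g.toContMDiffRiemannianMetric hg)) = 1 →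
          3 * Real.log c ≤ ∫ x, (4 * τ * ((Λ x)⁻¹ ^ 2 * g.gradSq w x) - (w x) ^ 2 * Real.log ((w x) ^ 2)
              - 4 * (w x) ^ 2) * ((4 * Real.pi * τ) ^ (-(4 : ℝ) / 2) * (Λ x) ^ 4)
            ∂(riemannianMeasure (g.toContMDiffRiemannianMetric hg))) →
      ∀ σ : ℝ, 0 < σ → ∀ v : M → ℝ, ContMDiff (𝓡 4) 𝓘(ℝ, ℝ) ∞ v → (∀ x, v x ≠ 0 → x ∈ S) →
        ∫ x, (4 * Real.pi * σ) ^ (-(4 : ℝ) / 2) * (v x) ^ 2 * (Φ x) ^ 4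
            ∂(riemannianMeasure (g.toContMDiffRiemannianMetric hg)) = 1 →
          3 * Real.log c ≤ ∫ x, (σ * (rG x * (v x) ^ 2 + 4 * ((Φ x)⁻¹ ^ 2 * g.gradSq v x))
              - (v x) ^ 2 * Real.log ((v x) ^ 2) - 4 * (v x) ^ 2)
              * ((4 * Real.pi * σ) ^ (-(4 : ℝ) / 2) * (Φ x) ^ 4)
            ∂(riemannianMeasure (g.toContMDiffRiemannianMetric hg)) := by
  intro M _ _ _ _ _ _ _ _ _ g _ hg p Λ Φ rG c S hΦ hΦpos hrG hrG0 hS hp hfloor σ hσ v hv hsupp hnorm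
  -- support facts: `v` and `|∇v|²` vanish off `closure S`
  have hv0 : ∀ x, x ∉ closure S → v x = 0 := fun x hx ↦ by
    by_contra h
    exact hx (subset_closure (hsupp x h))
  have htsupp : tsupport v ⊆ closure S := closure_mono fun x hx ↦ hsupp x hx
  have hG0 : ∀ x, x ∉ closure S → g.gradSq v x = 0 := fun x hx ↦
    g.gradSq_eq_zero_of_mvfderiv_eq_zero (mvfderiv_eq_zero_of_notMem_tsupport fun h ↦ hx (htsupp h))
  -- (1) `v` vanishes near `p`
  have hvp : v =ᶠ[𝓝 p] 0 := by
    filter_upwards [isClosed_closure.isOpen_compl.mem_nhds hp] with x hx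
    exact hv0 x hx
  -- (2) the normalisation for `Λ`
  have hsq : ∀ x, (v x) ^ 2 * (Λ x) ^ 4 = (v x) ^ 2 * (Φ x) ^ 4 := by
    intro x
    by_cases hx : x ∈ closure S
    · rw [(hS x hx).2]
    · rw [hv0 x hx]; ring
  have hnormΛ : ∫ x, (4 * Real.pi * σ) ^ (-(4 : ℝ) / 2) * (v x) ^ 2 * (Λ x) ^ 4
      ∂(riemannianMeasure (g.toContMDiffRiemannianMetric hg)) = 1 := by
    rw [← hnorm]
    refine integral_congr_ae (ae_of_all _ fun x ↦ ?_)
    simp only [mul_assoc, hsq x]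
  have key := hfloor σ hσ v hv hvp hnormΛ
  -- (3) the `R`-free density for `Λ` is the `R`-free density for `Φ`
  have hIJ : (fun x ↦ (4 * σ * ((Λ x)⁻¹ ^ 2 * g.gradSq v x) - (v x) ^ 2 * Real.log ((v x) ^ 2)
        - 4 * (v x) ^ 2) * ((4 * Real.pi * σ) ^ (-(4 : ℝ) / 2) * (Λ x) ^ 4)) =
      fun x ↦ (4 * σ * ((Φ x)⁻¹ ^ 2 * g.gradSq v x) - (v x) ^ 2 * Real.log ((v x) ^ 2)
        - 4 * (v x) ^ 2) * ((4 * Real.pi * σ) ^ (-(4 : ℝ) / 2) * (Φ x) ^ 4) := by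
    funext x
    by_cases hx : x ∈ closure S
    · rw [(hS x hx).2]
    · simp only [hv0 x hx, hG0 x hx]
      ring
  rw [hIJ] at key
  -- (4) compare with the density with potential `r_G ≥ 0`
  have hvc : Continuous v := hv.continuous
  have hΦc : Continuous Φ := hΦ.continuous
  have hG : Continuous (g.gradSq v) := (contMDiff_gradSq g hv).continuous
  have hinv : Continuous fun x ↦ (Φ x)⁻¹ := hΦc.inv₀ fun x ↦ (hΦpos x).ne'
  have hv2 : Continuous fun x ↦ (v x) ^ 2 := hvc.pow 2
  have hlog : Continuous fun x ↦ (v x) ^ 2 * Real.log ((v x) ^ 2) := Real.continuous_mul_log.comp hv2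
  have hW : Continuous fun x ↦ (4 * Real.pi * σ) ^ (-(4 : ℝ) / 2) * (Φ x) ^ 4 :=
    continuous_const.mul (hΦc.pow 4)
  have hD0 : Continuous fun x ↦ 4 * σ * ((Φ x)⁻¹ ^ 2 * g.gradSq v x) :=
    continuous_const.mul ((hinv.pow 2).mul hG)
  have hD : Continuous fun x ↦ σ * (rG x * (v x) ^ 2 + 4 * ((Φ x)⁻¹ ^ 2 * g.gradSq v x)) :=
    continuous_const.mul ((hrG.mul hv2).add (continuous_const.mul ((hinv.pow 2).mul hG)))
  have hJc : Continuous fun x ↦ (4 * σ * ((Φ x)⁻¹ ^ 2 * g.gradSq v x) - (v x) ^ 2 * Real.log ((v x) ^ 2)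
      - 4 * (v x) ^ 2) * ((4 * Real.pi * σ) ^ (-(4 : ℝ) / 2) * (Φ x) ^ 4) :=
    ((hD0.sub hlog).sub (continuous_const.mul hv2)).mul hW
  have hIc : Continuous fun x ↦ (σ * (rG x * (v x) ^ 2 + 4 * ((Φ x)⁻¹ ^ 2 * g.gradSq v x))
      - (v x) ^ 2 * Real.log ((v x) ^ 2) - 4 * (v x) ^ 2) * ((4 * Real.pi * σ) ^ (-(4 : ℝ) / 2) * (Φ x) ^ 4) :=
    ((hD.sub hlog).sub (continuous_const.mul hv2)).mul hW
  refine key.trans (integral_mono (EntropyLocalisation.integrable_of_continuous g hg hJc)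
    (EntropyLocalisation.integrable_of_continuous g hg hIc) fun x ↦ ?_)
  have hcσ : 0 ≤ (4 * Real.pi * σ) ^ (-(4 : ℝ) / 2) := by positivity
  have hextra : 0 ≤ σ * (rG x * (v x) ^ 2) * ((4 * Real.pi * σ) ^ (-(4 : ℝ) / 2) * (Φ x) ^ 4) :=
    mul_nonneg (mul_nonneg hσ.le (mul_nonneg (hrG0 x) (sq_nonneg _)))
      (mul_nonneg hcσ (pow_nonneg (hΦpos x).le 4))
  dsimp only
  nlinarith [hextra]

end Summit.SmoothPoincare4.SmoothPoincare4.Theorems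

end
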